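import Summits.BirchSwinnertonDyer.BirchSwinnertonDyer.Theorems.KolyvaginDepthDoorDepthTableKuriharaSocket643a1
import Summits.BirchSwinnertonDyer.BirchSwinnertonDyer.Theorems.KolyvaginDepthDoorDepthTableRowKitPrint
import Summits.BirchSwinnertonDyer.Rank1Residual.Supersingular.CountPointsFast
import Summits.BirchSwinnertonDyer.Rank1Residual.Additive.X4ThreeKuriharaCertKernel
import Literature.NumberTheory.EllipticCurves.GlobalMinimalModelNumberFieldBaseChangeProofs
import Literature.NumberTheory.EllipticCurves.BSDSelmerPConverseSerreProofs
import HarnessLib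

/-!
# Route `KolyvaginDepthDoor`, crux `KolyvaginDepthSupplyKN` (stmt-BirchSwinnertonDyer-22820) —
# DEPTH TABLE v28, ROW `643a1` @ `(5, d_K = −11)` — an ODD Heegner field for the prime-conductor curve `643a1`: the twist model
# `T₀ = [1, 0, 1, -487, -4479]` of `643a1^{(−11)}`, its kernel facts at `5` and at the Kolyvagin prime `31`, and the SOCKET of the row

Helper file of the lead prover of line `levelone` (kdd-p1 g33; `--supports stmt-BirchSwinnertonDyer-22820 --as helper`); it closes
nothing and BSD is NOT proved by it. WHY A NEW FIELD. The row of record of `643a1` uses `d_K = −8` (even conductor of the twist,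
`2⁶ ∣ N_{T}`), whose twist side cannot be certified at prime level by the v27 kit (the tree's twist `L`-function identity
`LFunction_quadraticTwist_apply_of_emod_four_eq_one` wants `d ≡ 1 (mod 4)`). The crux is `∃ p ∃ K`: at the Heegner field
`K = ℚ(√−11)` of `643` (`(−11/643) = 1`, `heegner_neg11`; `5 ∤ 11`) the twist side IS reachable (sibling files `…MSymbolCert643a1Twist11`,
`…KuriharaRow643a1Neg11CertifiedT`). This file supplies, all in the kernel:
* §0 `minTwist11_isElliptic/_isGloballyMinimal/_intModel/_smul_eq` — `T₀ = [1, 0, 1, -487, -4479]`, `Δ(T₀) = −11⁶·643` (twelfth-power free),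
  `(u,r,s,t) = (1, (-1 : ℚ), -((1 : ℚ) / 2), (0 : ℚ)) • T₀ = E.quadraticTwist (−11)`;
* `heegner_neg11` — every prime of `Δ(E) = −643` splits in `K` (`(−11/643) = 1`);
* §1 `minTwist11_card_5` (`#T̃₀(𝔽_5) = 8`), `minTwist11_nonAnomalous_5`, `minTwist11_kodairaNeron_5` (exponents `6, 1` of `Δ(T₀)`),
  `minTwist11_card_31` (`#T̃₀(𝔽_31) = 35`), `minTwist11_isCyclicKolyvaginLevel_5_31`;
* §2 `cruxBody_of_kuriharaClaims_5_neg11` — THE SOCKET (v17 generic `cruxBody_of_kuriharaClaims_spade`): the clause of the crux at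
  `W = 643a1` VERBATIM for every `K` with `d_K = −11`, from Kim Thm. 1.11 / modularity / Mazur Cor. 4.1 / W. Zhang L8.4 (1)+9.1 BY NAME,
  the E-side Kurihara claim at `(5, 1271)` (`hδE`; a kernel THEOREM since v27: `C643a1.kuriharaClaim_5_1271`) and the twist-side claim
  at `(5, 31)` (`hδT`, discharged in `…KuriharaRow643a1Neg11CertifiedT`).
CONDITIONAL on the named facts and the two claims; per curve; nothing class-wide; BSD is NOT proved by any of this.

References: [Kim2022StructureSelmer] Thm. 1.11, §1.2.2; [WZhang2014] Lemma 8.4 (1), Thm. 9.1; [GrossLMS1991] §1; [Mazur1978] Cor. 4.1;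
[Serre1972] §4.2 Thm. 2; [SilvermanAEC2009] VII.1 Rem. 1.1, VII.5.1, VIII.8, X.5 Cor. 5.4; [CremonaAlgorithms1997] Table 1 (643a1).
-/

set_option linter.dupNamespace false

noncomputable section

open scoped Classical NumberField

namespace Summit.BirchSwinnertonDyer.BirchSwinnertonDyer.Theorems.KolyvaginDepthDoor

open Literature.NumberTheory.EllipticCurves Literature.NumberTheory.EllipticCurves.ModularForms
  WeierstrassCurve NumberField IsDedekindDomain
open Summit.BirchSwinnertonDyer.BirchSwinnertonDyer.Theorems
open Summit.BirchSwinnertonDyer.BirchSwinnertonDyer.Rank2Observatory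
open Summit.BirchSwinnertonDyer.BirchSwinnertonDyer.Rank1Residual (IntModel.frobeniusTrace_eq IntModel.integralModelInt_eq_of_map_eq)
open Summit.BirchSwinnertonDyer.Rank1Residual.Supersingular (natCard_point_eq_of_countPoints countPoints_eq_of_fast)
open Summit.BirchSwinnertonDyer.Rank1Residual.Additive (card_torsion_le_of_intModel_of_card
  isKolyvaginPrime_of_intModel_of_card)

namespace C643a1

/-! ## §0 The minimal model `T₀ = [1, 0, 1, -487, -4479]` of the twist `643a1^{(-11)}` -/

/-- `T₀ = [1, 0, 1, -487, -4479]` is an elliptic curve over `ℚ` (`Δ = -1139113723 ≠ 0`, kernel-checked). [folklore] -/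
theorem minTwist11_isElliptic : (((⟨1, 0, 1, -487, -4479⟩ : WeierstrassCurve ℤ).map (Int.castRingHom ℚ))).IsElliptic := by
  rw [WeierstrassCurve.isElliptic_iff, WeierstrassCurve.map_Δ, isUnit_iff_ne_zero, eq_intCast, Int.cast_ne_zero]
  decide +kernel

/-- **`T₀ = [1, 0, 1, -487, -4479]` is a GLOBAL MINIMAL model** (unconditional): `Δ(T₀) = −11^6 · 643` is twelfth-power-free
(a prime `q` with `q¹² ∣ Δ` has `q < 6`, and none of those does), so Silverman's `Δ`-criterion
`isGloballyMinimal_baseChange_int_of_finrank_mul_lt_twelve` applies with `k = 11`. [cite: SilvermanAEC2009, VII.1 Remark 1.1 and VIII.8] -/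
theorem minTwist11_isGloballyMinimal : (((⟨1, 0, 1, -487, -4479⟩ : WeierstrassCurve ℤ).map (Int.castRingHom ℚ))).IsGloballyMinimal := by
  have hbc : (⟨1, 0, 1, -487, -4479⟩ : WeierstrassCurve ℤ).map (Int.castRingHom ℚ) = (⟨1, 0, 1, -487, -4479⟩ : WeierstrassCurve ℤ).baseChange ℚ := by
    ext <;> simp [WeierstrassCurve.baseChange, WeierstrassCurve.map]
  rw [hbc]
  refine isGloballyMinimal_baseChange_int_of_finrank_mul_lt_twelve _ ℚ 11 (fun q hq hdvd ↦ ?_)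
    (by rw [Module.finrank_self]; norm_num)
  have hΔ : (⟨1, 0, 1, -487, -4479⟩ : WeierstrassCurve ℤ).Δ = -(1139113723 : ℕ) := by decide +kernel
  rw [hΔ, Int.dvd_neg] at hdvd
  have h1 : q ^ 12 ∣ 1139113723 := by exact_mod_cast hdvd
  have hle : q ^ 12 ≤ 1139113723 := Nat.le_of_dvd (by norm_num) h1
  have hqM : q < 6 := by
    by_contra h
    have hM : 6 ^ 12 ≤ q ^ 12 := Nat.pow_le_pow_left (by omega) 12
    norm_num at hM
    omega
  interval_cases q <;> first | (norm_num at hq; done) | exact absurd h1 (by decide +kernel)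

/-- The integral model `[1, 0, 1, -487, -4479]` is its own `integralModelInt` (globally minimal). [folklore] -/
theorem minTwist11_intModel :
    haveI := minTwist11_isGloballyMinimal;
    integralModelInt (((⟨1, 0, 1, -487, -4479⟩ : WeierstrassCurve ℤ).map (Int.castRingHom ℚ))) = ⟨1, 0, 1, -487, -4479⟩ := by
  haveI := minTwist11_isGloballyMinimal
  exact IntModel.integralModelInt_eq_of_map_eq _ rfl

/-- **`T₀` is `ℚ`-isomorphic to the tree's twist `E.quadraticTwist (-11)` of `E = 643a1`** by the change of variables
`(u, r, s, t) = (1, (-1 : ℚ), -((1 : ℚ) / 2), (0 : ℚ))`: `(u,r,s,t) • T₀ = ⟨0, d·b₂/4, 0, d²·b₄/2, d³·b₆/4⟩` with `(b₂, b₄, b₆)(E) = (1, -8, 12)`,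
`d = -11`. [cite: SilvermanAEC2009, X.5 Cor. 5.4] -/
theorem minTwist11_smul_eq :
    (⟨1, (-1 : ℚ), -((1 : ℚ) / 2), (0 : ℚ)⟩ : WeierstrassCurve.VariableChange ℚ) • (((⟨1, 0, 1, -487, -4479⟩ : WeierstrassCurve ℤ).map (Int.castRingHom ℚ))) =
      (((⟨1, 0, 0, -4, 3⟩ : WeierstrassCurve ℤ).map (Int.castRingHom ℚ))).quadraticTwist ((-11) : ℚ) := by
  haveI := isElliptic_c643a1
  haveI := isGloballyMinimal_c643a1
  ext <;> simp only [WeierstrassCurve.map_a₁, WeierstrassCurve.map_a₂, WeierstrassCurve.map_a₃,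
      WeierstrassCurve.map_a₄, WeierstrassCurve.map_a₆, WeierstrassCurve.variableChange_a₁,
      WeierstrassCurve.variableChange_a₂, WeierstrassCurve.variableChange_a₃,
      WeierstrassCurve.variableChange_a₄, WeierstrassCurve.variableChange_a₆, WeierstrassCurve.quadraticTwist,
      WeierstrassCurve.b₂, WeierstrassCurve.b₄, WeierstrassCurve.b₆, Units.val_one, inv_one,
      eq_intCast] <;> norm_num

/-- **Heegner data `d_K = -11` for `643a1`**: every prime of `Δ = -643` (hence of `N_E`) splits in a quadratic
field of discriminant `-11` (`(-11/643) = 1`). [cite: Marcus1977, Ch. 3 Thm. 25] [cite: GrossLMS1991, §1] -/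
theorem heegner_neg11 : ∀ q : ℕ, q.Prime → (q : ℤ) ∣ (⟨1, 0, 0, -4, 3⟩ : WeierstrassCurve ℤ).Δ →
    (q = 2 → (-11 : ℤ) % 8 = 1) ∧ (q ≠ 2 → jacobiSym (-11) q = 1) :=
  forall_prime_dvd_of_natAbs_eq_pow (a := 643) (i := 1) (by decide +kernel) (by norm_num)
    ⟨by norm_num, by norm_num⟩

/-! ## §1 The twist model at `5` and at the Kolyvagin prime `31` (kernel) -/

/-- `#T̃₀(𝔽_5) = 8` for `T₀ = [1, 0, 1, -487, -4479]` (`a_5(T₀) = -2`), kernel-decided (`countPointsFast`). [cite: SilvermanAEC2009, V.2] -/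
theorem minTwist11_card_5 :
    Nat.card (((⟨1, 0, 1, -487, -4479⟩ : WeierstrassCurve ℤ).map (Int.castRingHom (ZMod 5))).toAffine.Point) = 8 :=
  haveI : Fact (Nat.Prime 5) := ⟨by norm_num⟩
  natCard_point_eq_of_countPoints 1 0 1 (-487) (-4479) 5 (by norm_num) (by decide +kernel) (n := 8)
    (countPoints_eq_of_fast (by decide +kernel))

/-- **`5` is non-anomalous for `T₀`**: `5 ∤ a_5(T₀) − 1 = -3`. [cite: SilvermanAEC2009, VII.3 Prop. 3.1] -/
theorem minTwist11_nonAnomalous_5 :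
    haveI := minTwist11_isGloballyMinimal; haveI := Fact.mk (by norm_num : Nat.Prime 5);
    ¬ ((5 : ℕ) : ℤ) ∣ (((⟨1, 0, 1, -487, -4479⟩ : WeierstrassCurve ℤ).map (Int.castRingHom ℚ))).frobeniusTrace 5 - 1 := by
  haveI := minTwist11_isElliptic
  haveI := minTwist11_isGloballyMinimal
  haveI := Fact.mk (by norm_num : Nat.Prime 5)
  rw [IntModel.frobeniusTrace_eq minTwist11_intModel minTwist11_card_5]
  decide

/-- **Kodaira–Néron for `T₀` at `5`**: `5 ∤ ord_v(Δ_{T₀})` at every multiplicative place (`|Δ(T₀)| = 11⁶·643 < 65^5`;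
exponents `6, 1`, none divisible by `5`; table lemma `not_dvd_ordMinimalDiscriminant_of_intModel_table`).
[cite: SilvermanAEC2009, VII.5.1, VIII.8] -/
theorem minTwist11_kodairaNeron_5 :
    haveI := minTwist11_isElliptic; haveI := minTwist11_isGloballyMinimal;
    ∀ v : HeightOneSpectrum (𝓞 ℚ), (((⟨1, 0, 1, -487, -4479⟩ : WeierstrassCurve ℤ).map (Int.castRingHom ℚ))).HasMultiplicativeReductionAt v → ¬ 5 ∣ (((⟨1, 0, 1, -487, -4479⟩ : WeierstrassCurve ℤ).map (Int.castRingHom ℚ))).ordMinimalDiscriminant v := by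
  haveI := minTwist11_isElliptic
  haveI := minTwist11_isGloballyMinimal
  exact not_dvd_ordMinimalDiscriminant_of_intModel_table minTwist11_intModel (p := 5) (Δ₀ := -1139113723)
    (by decide +kernel) (B := 65) (by decide +kernel)
    (by
      intro q hq hqP hqd
      have hn : ((-1139113723 : ℤ).natAbs) = 11 ^ 6 * (643 ^ 1) := by norm_num
      rw [hn] at hqd ⊢
      rcases (Nat.Prime.dvd_mul hqP).mp hqd with h | h0
      · obtain rfl := (Nat.prime_dvd_prime_iff_eq hqP (by norm_num)).mp (hqP.dvd_of_dvd_pow h)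
        exact ⟨6, by simp, by decide +kernel, by decide +kernel, by norm_num⟩
      · obtain rfl := (Nat.prime_dvd_prime_iff_eq hqP (by norm_num)).mp (hqP.dvd_of_dvd_pow h0)
        exact absurd (Finset.mem_range.mp hq) (by norm_num))

/-- `#T̃₀(𝔽_31) = 35` (`31 ≡ 1 (mod 5)`, `a_31(T₀) = -3 ≡ 2 (mod 5)`, `5² ∤ 35`), kernel-decided (`countPointsFast`).
[cite: Kim2022StructureSelmer, §1.2.2 (PDF p. 5)] -/
theorem minTwist11_card_31 :
    Nat.card (((⟨1, 0, 1, -487, -4479⟩ : WeierstrassCurve ℤ).map (Int.castRingHom (ZMod 31))).toAffine.Point) = 35 :=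
  haveI : Fact (Nat.Prime 31) := ⟨by norm_num⟩
  natCard_point_eq_of_countPoints 1 0 1 (-487) (-4479) 31 (by norm_num) (by decide +kernel) (n := 35)
    (countPoints_eq_of_fast (by decide +kernel))

/-- **`31` is a CYCLIC KOLYVAGIN LEVEL for `(T₀, 5)`** (`31 ∤ 5·N_{T₀}`, `31 ≡ 1`, `a_31(T₀) ≡ 2 (mod 5)`, `#T̃₀(𝔽_31)[5] ≤ 5`).
[cite: Kim2022StructureSelmer, §1.2.2 (PDF p. 5)] -/
theorem minTwist11_isCyclicKolyvaginLevel_5_31 :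
    haveI := minTwist11_isGloballyMinimal; haveI := Fact.mk (by norm_num : Nat.Prime 5);
    IsCyclicKolyvaginLevel (((⟨1, 0, 1, -487, -4479⟩ : WeierstrassCurve ℤ).map (Int.castRingHom ℚ))) 5 31 := by
  haveI := minTwist11_isElliptic
  haveI := minTwist11_isGloballyMinimal
  haveI := Fact.mk (by norm_num : Nat.Prime 5)
  haveI : Fact (Nat.Prime 31) := ⟨by norm_num⟩
  have hℓ : Kato.IsKolyvaginPrime (((⟨1, 0, 1, -487, -4479⟩ : WeierstrassCurve ℤ).map (Int.castRingHom ℚ))) 5 1 31 :=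
    isKolyvaginPrime_of_intModel_of_card minTwist11_intModel 5 1 31 (by norm_num) (by decide +kernel) (by decide)
      minTwist11_card_31 (by norm_num)
  refine ⟨⟨Nat.squarefree_iff_nodup_primeFactorsList (by norm_num) |>.mpr (by simp), fun ℓ hℓ' ↦ ?_⟩, fun ℓ hℓ' hdvd ↦ ?_⟩
  · rw [show (31 : ℕ).primeFactors = {31} from (Nat.Prime.primeFactors (by norm_num)), Finset.mem_singleton] at hℓ'
    exact hℓ' ▸ hℓ
  · obtain rfl := (Nat.prime_dvd_prime_iff_eq hℓ'.out (by norm_num)).mp hdvd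
    exact card_torsion_le_of_intModel_of_card minTwist11_intModel 5 31 minTwist11_card_31 (by norm_num)

/-! ## §2 The socket: the crux's clause at `643a1` from the two Kurihara claims at `(5, −11)` -/

/-- **THE SOCKET for row `643a1` @ `(5, −11)`.** For EVERY imaginary quadratic `K` with `d_K = −11`: granted Kim 2026 Thm. 1.11
(`hKim`), modularity (`hnf`), Mazur 1978 Cor. 4.1 (`hMaz`), W. Zhang 2014 L8.4 (1)/9.1 (`h84`) BY NAME, the E-side Kurihara claim at
`(5, 1271)` (`hδE`) and the twist-side claim for `T₀` at `(5, 31)` (`hδT`), the clause of `KolyvaginDepthSupplyKN` holds at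
`W = 643a1` VERBATIM: witnesses `p = 5` (good ordinary, `ρ_{E,5^n}` onto by Serre's tower theorem, Kodaira–Néron), that `K`
(`heegner_neg11`), W. Zhang's level-one class, first sign (`rank E = 2`). CONDITIONAL on the four named facts and the two claims;
per curve; nothing class-wide; BSD is not proved by it. [cite: Kim2022StructureSelmer, Thm. 1.11 (PDF p. 8)]
[cite: WZhang2014, Lemma 8.4 (1) (p. 236), Thm. 9.1 (p. 240)] [cite: Mazur1978, Cor. 4.1] [cite: Serre1972, §4.2 Thm. 2]
[cite: CremonaAlgorithms1997, Table 1 (643a1)] -/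
theorem cruxBody_of_kuriharaClaims_5_neg11
    (hKim : Kim2022_card_selmerGroup_le_pow_of_kuriharaNumber_ne_zero)
    (hnf : exists_isNewformOf) (hMaz : mazur_not_dvd_maninConstant_of_odd)
    (h84 : Literature.NumberTheory.EllipticCurves.WZhang2014_lemma84_exists_minimal_kolyvaginClass_one_selmerCard)
    (K : Type) [Field K] [NumberField K] (hK : IsImaginaryQuadratic K) (hD : NumberField.discr K = -11)
    (hδE : haveI := isElliptic_c643a1; haveI := isGloballyMinimal_c643a1;
      haveI : NeZero ((((⟨1, 0, 0, -4, 3⟩ : WeierstrassCurve ℤ).map (Int.castRingHom ℚ))).conductorNorm ℤ) :=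
        neZero_conductorNorm_of_isElliptic _;
      haveI := Fact.mk (by norm_num : Nat.Prime 5);
      ∀ (D : ModularParametrizationData (((⟨1, 0, 0, -4, 3⟩ : WeierstrassCurve ℤ).map (Int.castRingHom ℚ)))
          ((((⟨1, 0, 0, -4, 3⟩ : WeierstrassCurve ℤ).map (Int.castRingHom ℚ))).conductorNorm ℤ)),
        ¬ ((5 : ℕ) : ℤ) ∣ D.maninConstant →
        (∃ u : ℚ, ‖(u : ℚ_[5])‖ = 1 ∧
          (((⟨1, 0, 0, -4, 3⟩ : WeierstrassCurve ℤ).map (Int.castRingHom ℚ))).realPeriodRat = u * plusPeriod D.f) →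
        ∃ ψ : (ℓ : ℕ) → (ZMod ℓ)ˣ →* Multiplicative (ZMod 5),
          (∀ ℓ ∈ (1271 : ℕ).primeFactors, Function.Surjective (ψ ℓ)) ∧ kuriharaNumber D.f 5 1271 ψ ≠ 0)
    (hδT : haveI := minTwist11_isElliptic; haveI := minTwist11_isGloballyMinimal;
      haveI : NeZero ((((⟨1, 0, 1, -487, -4479⟩ : WeierstrassCurve ℤ).map (Int.castRingHom ℚ))).conductorNorm ℤ) :=
        neZero_conductorNorm_of_isElliptic _;
      haveI := Fact.mk (by norm_num : Nat.Prime 5);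
      ∀ (D : ModularParametrizationData (((⟨1, 0, 1, -487, -4479⟩ : WeierstrassCurve ℤ).map (Int.castRingHom ℚ)))
          ((((⟨1, 0, 1, -487, -4479⟩ : WeierstrassCurve ℤ).map (Int.castRingHom ℚ))).conductorNorm ℤ)),
        ¬ ((5 : ℕ) : ℤ) ∣ D.maninConstant →
        (∃ u : ℚ, ‖(u : ℚ_[5])‖ = 1 ∧
          (((⟨1, 0, 1, -487, -4479⟩ : WeierstrassCurve ℤ).map (Int.castRingHom ℚ))).realPeriodRat = u * plusPeriod D.f) →
        ∃ ψ : (ℓ : ℕ) → (ZMod ℓ)ˣ →* Multiplicative (ZMod 5),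
          (∀ ℓ ∈ (31 : ℕ).primeFactors, Function.Surjective (ψ ℓ)) ∧ kuriharaNumber D.f 5 31 ψ ≠ 0) :
    haveI := isElliptic_c643a1; haveI := isGloballyMinimal_c643a1;
    ∃ (p : ℕ) (hp : Fact p.Prime), 5 ≤ p ∧ (((⟨1, 0, 0, -4, 3⟩ : WeierstrassCurve ℤ).map (Int.castRingHom ℚ))).HasGoodReductionAtPrime p ∧
      ¬ (p : ℤ) ∣ (((⟨1, 0, 0, -4, 3⟩ : WeierstrassCurve ℤ).map (Int.castRingHom ℚ))).frobeniusTrace p ∧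
      (∀ n : ℕ, (((⟨1, 0, 0, -4, 3⟩ : WeierstrassCurve ℤ).map (Int.castRingHom ℚ))).HasSurjectiveModNGaloisRep (p ^ n : ℕ)) ∧
      (∀ v : HeightOneSpectrum (𝓞 ℚ), (((⟨1, 0, 0, -4, 3⟩ : WeierstrassCurve ℤ).map (Int.castRingHom ℚ))).HasMultiplicativeReductionAt v →
        ¬ p ∣ (((⟨1, 0, 0, -4, 3⟩ : WeierstrassCurve ℤ).map (Int.castRingHom ℚ))).ordMinimalDiscriminant v) ∧
      ∃ (K : Type) (_ : Field K) (_ : NumberField K), IsImaginaryQuadratic K ∧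
        NumberField.discr K ≠ -3 ∧ NumberField.discr K ≠ -4 ∧
        ∃ (_ : NeZero ((((⟨1, 0, 0, -4, 3⟩ : WeierstrassCurve ℤ).map (Int.castRingHom ℚ))).conductorNorm ℤ)),
          SatisfiesHeegnerHypothesis ((((⟨1, 0, 0, -4, 3⟩ : WeierstrassCurve ℤ).map (Int.castRingHom ℚ))).conductorNorm ℤ) K ∧
        ∃ (Dt : ModularParametrizationData (((⟨1, 0, 0, -4, 3⟩ : WeierstrassCurve ℤ).map (Int.castRingHom ℚ)))
            ((((⟨1, 0, 0, -4, 3⟩ : WeierstrassCurve ℤ).map (Int.castRingHom ℚ))).conductorNorm ℤ)) (β : ℤ) (ι : K →+* ℂ) (n₁ : ℕ)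
          (d : KolyvaginHeegnerData Dt β ι n₁), Squarefree n₁ ∧
          (∀ q ∈ n₁.primeFactors, Zhang2014.IsKolyvaginPrime ((((⟨1, 0, 0, -4, 3⟩ : WeierstrassCurve ℤ).map (Int.castRingHom ℚ))).conductorNorm ℤ)
            (((⟨1, 0, 0, -4, 3⟩ : WeierstrassCurve ℤ).map (Int.castRingHom ℚ))) K p q) ∧
          d.kolyvaginClass hp.out 1 ≠ 0 ∧
          (n₁.primeFactors.card + 1 ≤ (((⟨1, 0, 0, -4, 3⟩ : WeierstrassCurve ℤ).map (Int.castRingHom ℚ))).mordellWeilRank ∨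
            (n₁.primeFactors.card ≤ (((⟨1, 0, 0, -4, 3⟩ : WeierstrassCurve ℤ).map (Int.castRingHom ℚ))).mordellWeilRank ∧
              n₁.primeFactors.card + 1 ≤
                ((((⟨1, 0, 0, -4, 3⟩ : WeierstrassCurve ℤ).map (Int.castRingHom ℚ))).quadraticTwist (NumberField.discr K : ℚ)).mordellWeilRank)) := by
  haveI := isElliptic_c643a1
  haveI := isGloballyMinimal_c643a1
  haveI iNZ : NeZero ((((⟨1, 0, 0, -4, 3⟩ : WeierstrassCurve ℤ).map (Int.castRingHom ℚ))).conductorNorm ℤ) :=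
    neZero_conductorNorm_of_isElliptic _
  haveI iP := Fact.mk (by norm_num : Nat.Prime 5)
  haveI := minTwist11_isElliptic
  haveI := minTwist11_isGloballyMinimal
  haveI iNZT : NeZero ((((⟨1, 0, 1, -487, -4479⟩ : WeierstrassCurve ℤ).map (Int.castRingHom ℚ))).conductorNorm ℤ) :=
    neZero_conductorNorm_of_isElliptic _
  haveI : NeZero (1271 : ℕ) := ⟨by norm_num⟩
  haveI : NeZero (31 : ℕ) := ⟨by norm_num⟩
  have hsp := spadeOne_of_five_le 5 (by norm_num)
  have hS2 : ¬ Squarefree ((((⟨1, 0, 0, -4, 3⟩ : WeierstrassCurve ℤ).map (Int.castRingHom ℚ))).conductorNorm ℤ) →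
      (∃ (ℓ : ℕ) (_ : Fact ℓ.Prime), (((⟨1, 0, 0, -4, 3⟩ : WeierstrassCurve ℤ).map (Int.castRingHom ℚ))).HasMultiplicativeReductionAtPrime ℓ ∧
          ¬ 5 ∣ padicValInt ℓ (((⟨1, 0, 0, -4, 3⟩ : WeierstrassCurve ℤ).map (Int.castRingHom ℚ))).minimalDiscriminantInt) ∧
        ∃ (ℓ₁ ℓ₂ : ℕ) (_ : Fact ℓ₁.Prime) (_ : Fact ℓ₂.Prime), ℓ₁ ≠ ℓ₂ ∧
          (((⟨1, 0, 0, -4, 3⟩ : WeierstrassCurve ℤ).map (Int.castRingHom ℚ))).HasMultiplicativeReductionAtPrime ℓ₁ ∧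
          (((⟨1, 0, 0, -4, 3⟩ : WeierstrassCurve ℤ).map (Int.castRingHom ℚ))).HasMultiplicativeReductionAtPrime ℓ₂ :=
    fun hns ↦ absurd ((((⟨1, 0, 0, -4, 3⟩ : WeierstrassCurve ℤ).map (Int.castRingHom ℚ))).isSemistable_iff_squarefree_conductorNorm.mp hsp.2) hns
  have hH : SatisfiesHeegnerHypothesis ((((⟨1, 0, 0, -4, 3⟩ : WeierstrassCurve ℤ).map (Int.castRingHom ℚ))).conductorNorm ℤ) K :=
    satisfiesHeegnerHypothesis_conductorNorm_of_intModel intModel K hK.1 hD heegner_neg11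
  have hD3 : NumberField.discr K ≠ -3 := by rw [hD]; norm_num
  have hD4 : NumberField.discr K ≠ -4 := by rw [hD]; norm_num
  have hpD : ¬ (((5 : ℕ) : ℤ) ∣ NumberField.discr K) := by rw [hD]; decide
  have htower : ∀ k : ℕ, (((⟨1, 0, 0, -4, 3⟩ : WeierstrassCurve ℤ).map (Int.castRingHom ℚ))).HasSurjectiveModNGaloisRep (5 ^ k : ℕ) :=
    serre_hasSurjectiveModNGaloisRep_pow_holds _ 5 (by norm_num) hasSurjectiveModNGaloisRep_5
  have hC : (⟨1, (-1 : ℚ), -((1 : ℚ) / 2), (0 : ℚ)⟩ : WeierstrassCurve.VariableChange ℚ) •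
      (((⟨1, 0, 1, -487, -4479⟩ : WeierstrassCurve ℤ).map (Int.castRingHom ℚ))) =
      (((⟨1, 0, 0, -4, 3⟩ : WeierstrassCurve ℤ).map (Int.castRingHom ℚ))).quadraticTwist (NumberField.discr K : ℚ) := by
    rw [hD]; push_cast; exact minTwist11_smul_eq
  have hrank : 2 ≤ (((⟨1, 0, 0, -4, 3⟩ : WeierstrassCurve ℤ).map (Int.castRingHom ℚ))).mordellWeilRank := KernelCerts001.C643a1.two_le_rank
  have hν : (1271 : ℕ).primeFactors.card ≤ (((⟨1, 0, 0, -4, 3⟩ : WeierstrassCurve ℤ).map (Int.castRingHom ℚ))).mordellWeilRank := by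
    refine le_trans (le_of_eq ?_) hrank
    rw [show (1271 : ℕ) = 31 * 41 from rfl, Nat.primeFactors_mul (by norm_num) (by norm_num),
      Nat.Prime.primeFactors (by norm_num), Nat.Prime.primeFactors (by norm_num)]
    decide
  have hμ : (31 : ℕ).primeFactors.card ≤ (((⟨1, 0, 0, -4, 3⟩ : WeierstrassCurve ℤ).map (Int.castRingHom ℚ))).mordellWeilRank := by
    refine le_trans (le_of_eq ?_) (le_trans (by norm_num : 1 ≤ 2) hrank)
    rw [Nat.Prime.primeFactors (by norm_num), Finset.card_singleton]
  exact cruxBody_of_kuriharaClaims_spade hKim hnf hMaz h84 _ hrank 5 (by norm_num) goodOrdinary_5.1 goodOrdinary_5.2 htower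
    (kodairaNeron_of_five_le 5 (by norm_num)) nonAnomalous_5 hsp.1 hS2 K hK hD3 hD4 hpD hH
    1271 isCyclicKolyvaginLevel_5_1271 hν hδE
    (((⟨1, 0, 1, -487, -4479⟩ : WeierstrassCurve ℤ).map (Int.castRingHom ℚ))) _ hC minTwist11_nonAnomalous_5
    minTwist11_kodairaNeron_5 31 minTwist11_isCyclicKolyvaginLevel_5_31 hμ hδT

end C643a1

end Summit.BirchSwinnertonDyer.BirchSwinnertonDyer.Theorems.KolyvaginDepthDoor

end
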